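import Literature.Probability.Divergences.FDivVariational
import Literature.MathematicalPhysics.KineticTheory.HardSphereEuler
import Summits.AtomisticToContinuum.HydrodynamicLimit.Theses.TwoClocks

/-!
# The entropy-inequality glue `EntropyToHydro : RelEntropyVanishing → HydrodynamicLimit` (shared item stmt-AtomisticToContinuum-0769)

The last step of every relative-entropy route of this sub-problem (Yau 1991; Kipnis–Landim 1999,
Ch. 6 and App. 1 §8; Olla–Varadhan–Yau 1993 §3), and in particular of the docking statement
`Assembly` of route OneFlightGossipEngine (stmt-AtomisticToContinuum-14647, whose unfiled dock ends
here): if the law at time `t` of the hard-sphere system started from the local Gibbs law has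
relative entropy `o(N)` with respect to a reference local Gibbs law whose empirical fields
concentrate exponentially around the Euler fields, then the empirical fields at time `t` converge in
probability. Proved unconditionally, in three layers:

* `measureReal_mul_le_toReal_klDiv_add` — the ENTROPY INEQUALITY FOR EVENTS:
  `μ(A)·L ≤ KL(μ‖ν) + (e^L − 1)·ν(A)` for finite measures with `KL(μ‖ν) < ∞`, every measurable
  `A` and every real `L` (the tree's variational bound
  `Literature.Probability.Divergences.integral_le_toReal_klDiv_add_integral` tested on `L·𝟙_A`);
* `tendsto_measure_of_klDiv_div_tendsto_zero` — the SEQUENCE form: if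
  `ν_N(A_N) ≤ C e^{-(N+1)/C}` and `KL(μ_N‖ν_N)/(N+1) → 0` then `μ_N(A_N) → 0` (finite measures,
  ARBITRARY sets `A_N` — pass to the `ν_N`-measurable hull; `L_N = (N+1)/(2C)` gives
  `μ_N(A_N) ≤ 2C·KL_N/(N+1) + 2C²e^{-(N+1)/(2C)}`; `KL = ∞` at small `N` is harmless because
  `KL_N/(N+1) → 0` forces finiteness eventually);
* `tendstoHydroFieldsAt_of_klDiv` and `hydrodynamicLimit_of_relEntropyVanishing` — the hard-sphere
  specialisation: with `μ_N = (Φ_N.flow t)_* λ_N` (`HardSphereFlow.lawAt`) and `ν_N` the reference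
  local Gibbs law, `λ_N{z | Φ_N.flow t z deviates} ≤ μ_N{deviates}` (`Measure.le_map_apply`,
  `HardSphereFlow.measurable_flow`; no measurability of the deviation events is needed), so the
  three empirical fields converge in probability at time `t`; quantifying over profiles, `σ`, Euler
  solutions and flows gives `RelEntropyVanishing → HydrodynamicLimit`;
* `entropyToHydro_proof : TwoClocks.EntropyToHydro` — the shared item stmt-AtomisticToContinuum-0769
  (route TwoClocks' copy; every other wanting route's copy is the same term definitionally).

prover-pitem-stmt-AtomisticToContinuum-14647-0 (independent of the candidate file Proof9240.lean
attached to 0769, which goes through `KipnisLandim1999_A1_8_2`; this file needs only the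
Fenchel–Young half of the variational formula already proved in the tree).
-/

noncomputable section

open MeasureTheory Filter Topology Set InformationTheory
open scoped ENNReal

namespace Summit.AtomisticToContinuum.HydrodynamicLimit.Theorems

/-! ### Layer 1: the entropy inequality for events -/

/-- **Entropy inequality for events** (Yau / Kipnis–Landim form of the Gibbs–Donsker–Varadhan
bound): for finite measures `μ, ν` with `KL(μ ‖ ν) < ∞`, a measurable set `A` and any real `L`,
`μ(A) · L ≤ KL(μ ‖ ν) + (e^L − 1) · ν(A)`. Proof: the tree's variational bound
`∫ g dμ ≤ KL(μ‖ν) + ∫ (e^g − 1) dν` (`Literature.Probability.Divergences`) with `g = L · 𝟙_A`.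
[cite: KipnisLandim1999, Appendix 1 §8] -/
theorem measureReal_mul_le_toReal_klDiv_add {α : Type*} [MeasurableSpace α] {μ ν : Measure α}
    [IsFiniteMeasure μ] [IsFiniteMeasure ν] (hfin : klDiv μ ν ≠ ∞) {A : Set α}
    (hA : MeasurableSet A) (L : ℝ) :
    μ.real A * L ≤ (klDiv μ ν).toReal + (Real.exp L - 1) * ν.real A := by
  have hg : Integrable (A.indicator fun _ => L) μ := (integrable_const L).indicator hA
  have hfun : (fun x => Real.exp (A.indicator (fun _ => L) x) - 1) =
      A.indicator (fun _ => Real.exp L - 1) := by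
    funext x
    by_cases hx : x ∈ A <;> simp [hx]
  have hexp : Integrable (fun x => Real.exp (A.indicator (fun _ => L) x)) ν := by
    have h2 : (fun x => Real.exp (A.indicator (fun _ => L) x)) =
        fun x => A.indicator (fun _ => Real.exp L - 1) x + 1 := by
      funext x
      by_cases hx : x ∈ A <;> simp [hx]
    rw [h2]
    exact ((integrable_const _).indicator hA).add (integrable_const _)
  have h := Literature.Probability.Divergences.integral_le_toReal_klDiv_add_integral hfin hg hexp
  rw [hfun, integral_indicator_const _ hA, integral_indicator_const _ hA, smul_eq_mul,
    smul_eq_mul] at h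
  linarith

/-! ### Layer 2: `o(N)` relative entropy and exponential reference concentration -/

/-- **Relative entropy `o(N)` + exponential concentration of the reference ⟹ convergence in
probability.** For finite measures `μ_N, ν_N` on arbitrary measurable spaces and arbitrary sets
`A_N`: if `ν_N(A_N) ≤ C e^{-(N+1)/C}` for all `N` and `KL(μ_N ‖ ν_N)/(N+1) → 0`, then
`μ_N(A_N) → 0`. Proof: replace `A_N` by its `ν_N`-measurable hull, apply the entropy inequality
for events with `L_N = (N+1)/(2C)`:
`μ_N(A_N) ≤ 2C·KL_N/(N+1) + 2C²·e^{-(N+1)/(2C)} → 0`. [cite: KipnisLandim1999, Ch. 6 §1] -/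
theorem tendsto_measure_of_klDiv_div_tendsto_zero {Ω : ℕ → Type*} [∀ N, MeasurableSpace (Ω N)]
    (μ ν : ∀ N, Measure (Ω N)) [∀ N, IsFiniteMeasure (μ N)] [∀ N, IsFiniteMeasure (ν N)]
    (A : ∀ N, Set (Ω N)) {C : ℝ} (hC : 0 < C)
    (hconc : ∀ N : ℕ, ν N (A N) ≤ ENNReal.ofReal (C * Real.exp (-(C⁻¹ * ((N : ℝ) + 1)))))
    (hkl : Tendsto (fun N : ℕ => klDiv (μ N) (ν N) / ((N : ℝ≥0∞) + 1)) atTop (𝓝 0)) :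
    Tendsto (fun N : ℕ => μ N (A N)) atTop (𝓝 0) := by
  -- real-valued relative entropy per particle
  set k : ℕ → ℝ := fun N => (klDiv (μ N) (ν N)).toReal with hk
  have hcast : ∀ N : ℕ, ((N : ℝ≥0∞) + 1).toReal = (N : ℝ) + 1 := fun N => by
    rw [ENNReal.toReal_add (ENNReal.natCast_ne_top N) ENNReal.one_ne_top]
    simp
  have hk_tendsto : Tendsto (fun N : ℕ => k N / ((N : ℝ) + 1)) atTop (𝓝 0) := by
    have h := (ENNReal.tendsto_toReal ENNReal.zero_ne_top).comp hkl
    rw [ENNReal.toReal_zero] at h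
    refine h.congr' (Eventually.of_forall fun N => ?_)
    simp only [Function.comp_apply, hk]
    rw [ENNReal.toReal_div, hcast]
  -- eventually the relative entropy is finite
  have hfin : ∀ᶠ N : ℕ in atTop, klDiv (μ N) (ν N) ≠ ∞ := by
    filter_upwards [hkl.eventually (gt_mem_nhds zero_lt_one)] with N hN
    intro htop
    rw [htop, ENNReal.top_div_of_ne_top (by simp)] at hN
    exact absurd hN (by simp)
  -- the real upper bound and its limit
  set B : ℕ → ℝ := fun N =>
    2 * C * (k N / ((N : ℝ) + 1)) + 2 * C ^ 2 * Real.exp (-(((N : ℝ) + 1) / (2 * C))) with hB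
  have hB_tendsto : Tendsto B atTop (𝓝 0) := by
    have h1 : Tendsto (fun N : ℕ => 2 * C * (k N / ((N : ℝ) + 1))) atTop (𝓝 0) := by
      simpa using hk_tendsto.const_mul (2 * C)
    have h2 : Tendsto (fun N : ℕ => 2 * C ^ 2 * Real.exp (-(((N : ℝ) + 1) / (2 * C)))) atTop
        (𝓝 0) := by
      have hdiv : Tendsto (fun N : ℕ => ((N : ℝ) + 1) / (2 * C)) atTop atTop :=
        (tendsto_atTop_add_const_right _ 1 tendsto_natCast_atTop_atTop).atTop_div_const
          (by positivity)
      have hexp := Real.tendsto_exp_neg_atTop_nhds_zero.comp hdiv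
      simpa using hexp.const_mul (2 * C ^ 2)
    simpa using h1.add h2
  have hB_ennreal : Tendsto (fun N => ENNReal.ofReal (B N)) atTop (𝓝 0) := by
    simpa using ENNReal.tendsto_ofReal hB_tendsto
  -- the eventual pointwise bound `μ_N(A_N) ≤ B_N`
  have hbound : ∀ᶠ N : ℕ in atTop, μ N (A N) ≤ ENNReal.ofReal (B N) := by
    filter_upwards [hfin] with N hN
    set A' : Set (Ω N) := toMeasurable (ν N) (A N) with hA'
    have hA'm : MeasurableSet A' := measurableSet_toMeasurable _ _
    have hNpos : (0 : ℝ) < (N : ℝ) + 1 := by positivity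
    set L : ℝ := ((N : ℝ) + 1) / (2 * C) with hL
    have hLpos : 0 < L := by positivity
    -- reference mass of the hull
    have hq : (ν N).real A' ≤ C * Real.exp (-(C⁻¹ * ((N : ℝ) + 1))) := by
      rw [measureReal_def, hA', measure_toMeasurable]
      exact ENNReal.toReal_le_of_le_ofReal (by positivity) (hconc N)
    have hq0 : 0 ≤ (ν N).real A' := measureReal_nonneg
    -- entropy inequality for the event `A'`
    have hent := measureReal_mul_le_toReal_klDiv_add hN hA'm L
    have hexpL : (Real.exp L - 1) * (ν N).real A' ≤ C * Real.exp (-(((N : ℝ) + 1) / (2 * C))) := by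
      calc (Real.exp L - 1) * (ν N).real A'
          ≤ Real.exp L * (ν N).real A' := by
            apply mul_le_mul_of_nonneg_right (by linarith [Real.exp_pos L]) hq0
        _ ≤ Real.exp L * (C * Real.exp (-(C⁻¹ * ((N : ℝ) + 1)))) :=
            mul_le_mul_of_nonneg_left hq (Real.exp_pos L).le
        _ = C * (Real.exp L * Real.exp (-(C⁻¹ * ((N : ℝ) + 1)))) := by ring
        _ = C * Real.exp (-(((N : ℝ) + 1) / (2 * C))) := by
            have hLid : L + -(C⁻¹ * ((N : ℝ) + 1)) = -(((N : ℝ) + 1) / (2 * C)) := by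
              rw [hL]
              field_simp
              ring
            rw [← Real.exp_add, hLid]
    have hm0 : 0 ≤ (μ N).real A' := measureReal_nonneg
    have hk0 : 0 ≤ k N := ENNReal.toReal_nonneg
    have hmain : (μ N).real A' * L ≤ k N + C * Real.exp (-(((N : ℝ) + 1) / (2 * C))) := by
      simp only [hk]
      linarith
    have hmB : (μ N).real A' ≤ B N := by
      have h1 : (μ N).real A' ≤ (k N + C * Real.exp (-(((N : ℝ) + 1) / (2 * C)))) / L :=
        (le_div_iff₀ hLpos).mpr hmain
      have h2 : (k N + C * Real.exp (-(((N : ℝ) + 1) / (2 * C)))) / L =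
          2 * C * (k N / ((N : ℝ) + 1)) +
            2 * C ^ 2 * Real.exp (-(((N : ℝ) + 1) / (2 * C))) / ((N : ℝ) + 1) := by
        rw [hL]
        field_simp
      have h3 : 2 * C ^ 2 * Real.exp (-(((N : ℝ) + 1) / (2 * C))) / ((N : ℝ) + 1) ≤
          2 * C ^ 2 * Real.exp (-(((N : ℝ) + 1) / (2 * C))) := by
        refine div_le_self (by positivity) ?_
        linarith [(Nat.cast_nonneg N : (0 : ℝ) ≤ N)]
      rw [hB]
      linarith
    calc μ N (A N) ≤ μ N A' := measure_mono (subset_toMeasurable _ _)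
      _ = ENNReal.ofReal ((μ N).real A') := (ofReal_measureReal (measure_ne_top _ _)).symm
      _ ≤ ENNReal.ofReal (B N) := ENNReal.ofReal_le_ofReal hmB
  exact tendsto_of_tendsto_of_tendsto_of_le_of_le' tendsto_const_nhds hB_ennreal
    (Eventually.of_forall fun N => zero_le) hbound

/-! ### Layer 3: the hard-sphere specialisation -/

open Literature.MathematicalPhysics.KineticTheory Literature.Analysis.FluidPDE

/-- **Convergence in probability at time `t` from `o(N)` relative entropy w.r.t. a concentrating
local Gibbs reference** (the entropy-inequality step of Yau's method, hard-sphere setting): if the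
reference laws `ψ_N = localGibbsLaw σ a (u t) (θ t) N Φ_N` are finite and their empirical density /
momentum / energy fields concentrate exponentially around `(ρ, ρu, E)(t)`, and the law at time `t`
of the system started from `λ_N = localGibbsLaw σ a₀ u₀ θ₀ N Φ_N` has `KL(·‖ψ_N)/(N+1) → 0`, then
the empirical fields of `Φ_N.flow t z`, `z ∼ λ_N`, converge in probability to `(ρ, ρu, E)(t)`.
The flow enters only through `λ_N{z | Φ_N.flow t z ∈ A} ≤ ((Φ_N.flow t)_* λ_N)(A)`
(`Measure.le_map_apply`, `HardSphereFlow.measurable_flow`). [cite: Yau1991, §2] -/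
theorem tendstoHydroFieldsAt_of_klDiv {σ : ℝ} {a₀ θ₀ a : T3 → ℝ} {u₀ : T3 → V3}
    {ρ θ : ℝ → T3 → ℝ} {u : ℝ → T3 → V3} {t : ℝ}
    (Φ : (N : ℕ) → HardSphereFlow (Torus.geometry (Fin 3)) (hsDiameter σ N) (N + 1))
    [hfin₀ : ∀ N, IsFiniteMeasure (localGibbsLaw σ a₀ u₀ θ₀ N (Φ N))]
    [hfin : ∀ N, IsFiniteMeasure (localGibbsLaw σ a (u t) (θ t) N (Φ N))]
    (hconc : ∀ χ : T3 → ℝ, Continuous χ → ∀ δ : ℝ, 0 < δ → ∃ C : ℝ, 0 < C ∧ ∀ N : ℕ,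
      localGibbsLaw σ a (u t) (θ t) N (Φ N)
          {z | δ < |empiricalDensityField z χ - ∫ x, χ x * ρ t x|} ≤
        ENNReal.ofReal (C * Real.exp (-(C⁻¹ * (N + 1)))) ∧
      localGibbsLaw σ a (u t) (θ t) N (Φ N)
          {z | δ < ‖empiricalMomentumField z χ - ∫ x, (χ x * ρ t x) • u t x‖} ≤
        ENNReal.ofReal (C * Real.exp (-(C⁻¹ * (N + 1)))) ∧
      localGibbsLaw σ a (u t) (θ t) N (Φ N)
          {z | δ < |empiricalEnergyField z χ -
            ∫ x, χ x * totalEnergyDensity (ρ t x) (u t x) (θ t x)|} ≤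
        ENNReal.ofReal (C * Real.exp (-(C⁻¹ * (N + 1)))))
    (hkl : Tendsto (fun N : ℕ => klDiv ((Φ N).lawAt (localGibbsLaw σ a₀ u₀ θ₀ N (Φ N)) t)
      (localGibbsLaw σ a (u t) (θ t) N (Φ N)) / ((N : ℝ≥0∞) + 1)) atTop (𝓝 0)) :
    TendstoHydroFieldsAt (fun N => localGibbsLaw σ a₀ u₀ θ₀ N (Φ N)) Φ ρ u θ t := by
  intro χ hχ δ hδ
  obtain ⟨C, hC, hN⟩ := hconc χ hχ δ hδ
  -- the laws at time `t` and the transfer inequality along the flow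
  set μ : ∀ N : ℕ, Measure (Config (N + 1) (Fin 3) T3) := fun N =>
    (Φ N).lawAt (localGibbsLaw σ a₀ u₀ θ₀ N (Φ N)) t with hμ
  have hμfin : ∀ N, IsFiniteMeasure (μ N) := fun N => by
    simp only [hμ, HardSphereFlow.lawAt_eq]
    infer_instance
  have htransfer : ∀ (N : ℕ) (A : Set (Config (N + 1) (Fin 3) T3)),
      localGibbsLaw σ a₀ u₀ θ₀ N (Φ N) {z | (Φ N).flow t z ∈ A} ≤ μ N A := fun N A => by
    simp only [hμ, HardSphereFlow.lawAt_eq]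
    exact Measure.le_map_apply ((Φ N).measurable_flow t).aemeasurable A
  have key : ∀ A : ∀ N : ℕ, Set (Config (N + 1) (Fin 3) T3),
      (∀ N : ℕ, localGibbsLaw σ a (u t) (θ t) N (Φ N) (A N) ≤
        ENNReal.ofReal (C * Real.exp (-(C⁻¹ * ((N : ℝ) + 1))))) →
      Tendsto (fun N : ℕ => localGibbsLaw σ a₀ u₀ θ₀ N (Φ N) {z | (Φ N).flow t z ∈ A N}) atTop
        (𝓝 0) := fun A hA => by
    have h := tendsto_measure_of_klDiv_div_tendsto_zero μ
      (fun N => localGibbsLaw σ a (u t) (θ t) N (Φ N)) A hC hA hkl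
    exact tendsto_of_tendsto_of_tendsto_of_le_of_le tendsto_const_nhds h
      (fun N => zero_le) (fun N => htransfer N (A N))
  refine ⟨?_, ?_, ?_⟩
  · exact key (fun N => {z | δ < |empiricalDensityField z χ - ∫ x, χ x * ρ t x|})
      (fun N => (hN N).1)
  · exact key (fun N => {z | δ < ‖empiricalMomentumField z χ - ∫ x, (χ x * ρ t x) • u t x‖})
      (fun N => (hN N).2.1)
  · exact key (fun N => {z | δ < |empiricalEnergyField z χ -
        ∫ x, χ x * totalEnergyDensity (ρ t x) (u t x) (θ t x)|}) (fun N => (hN N).2.2)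

/-- **`RelEntropyVanishing → HydrodynamicLimit`** (the entropy-inequality glue of the relative
entropy method; Yau 1991, Olla–Varadhan–Yau 1993 §3, Kipnis–Landim 1999 Ch. 6). The hypothesis is,
verbatim, the shared typed target `RelEntropyVanishing` (stmt-AtomisticToContinuum-0766) of the
entropy routes of this sub-problem: for all continuous profiles there is `σ₀` such that for
`σ < σ₀`, every classical hs-Euler solution on `[0,T)` and every flow family, the initial local
Gibbs laws are probability measures and, if their fields converge at `t = 0`, then for every
`t < T` some activity profile `a_t` makes the reference local Gibbs law `(a_t, u_t, θ_t)` a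
probability measure whose empirical fields concentrate exponentially around `(ρ, ρu, E)(t)` while
`KL(lawAt Φ_N λ_N t ‖ reference)/(N+1) → 0`. The conclusion is the sub-problem Statement
`HydrodynamicLimit` (same `σ₀`; `tendstoHydroFieldsAt_of_klDiv` at each `t`). Hence the shared
glue item `EntropyToHydro` (stmt-AtomisticToContinuum-0769) of the sibling routes holds by this
theorem, definitionally. [cite: Yau1991, §2] -/
theorem hydrodynamicLimit_of_relEntropyVanishing
    (hRE : ∀ (a₀ θ₀ : T3 → ℝ) (u₀ : T3 → V3), Continuous a₀ → Continuous θ₀ → Continuous u₀ →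
      (∀ x, 0 < a₀ x) → (∀ x, 0 < θ₀ x) → ∃ σ₀ : ℝ, 0 < σ₀ ∧ ∀ σ : ℝ, 0 < σ → σ < σ₀ →
      ∀ (T : ℝ) (ρ θ : ℝ → T3 → ℝ) (u : ℝ → T3 → V3), IsHardSphereEulerSolution σ T ρ u θ →
      ∀ Φ : (N : ℕ) → HardSphereFlow (Torus.geometry (Fin 3)) (hsDiameter σ N) (N + 1),
      (∀ N, IsProbabilityMeasure (localGibbsLaw σ a₀ u₀ θ₀ N (Φ N))) ∧
      (TendstoHydroFieldsAt (fun N => localGibbsLaw σ a₀ u₀ θ₀ N (Φ N)) Φ ρ u θ 0 →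
        ∀ t ∈ Set.Ico 0 T, ∃ a : T3 → ℝ,
        (∀ N, IsProbabilityMeasure (localGibbsLaw σ a (u t) (θ t) N (Φ N))) ∧
        (∀ χ : T3 → ℝ, Continuous χ → ∀ δ : ℝ, 0 < δ → ∃ C : ℝ, 0 < C ∧ ∀ N : ℕ,
          localGibbsLaw σ a (u t) (θ t) N (Φ N)
              {z | δ < |empiricalDensityField z χ - ∫ x, χ x * ρ t x|} ≤
            ENNReal.ofReal (C * Real.exp (-(C⁻¹ * (N + 1)))) ∧
          localGibbsLaw σ a (u t) (θ t) N (Φ N)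
              {z | δ < ‖empiricalMomentumField z χ - ∫ x, (χ x * ρ t x) • u t x‖} ≤
            ENNReal.ofReal (C * Real.exp (-(C⁻¹ * (N + 1)))) ∧
          localGibbsLaw σ a (u t) (θ t) N (Φ N)
              {z | δ < |empiricalEnergyField z χ -
                ∫ x, χ x * totalEnergyDensity (ρ t x) (u t x) (θ t x)|} ≤
            ENNReal.ofReal (C * Real.exp (-(C⁻¹ * (N + 1))))) ∧
        Tendsto (fun N : ℕ => klDiv ((Φ N).lawAt (localGibbsLaw σ a₀ u₀ θ₀ N (Φ N)) t)
          (localGibbsLaw σ a (u t) (θ t) N (Φ N)) / ((N : ℝ≥0∞) + 1)) atTop (𝓝 0))) :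
    Literature.MathematicalPhysics.KineticTheory.HydrodynamicLimit := by
  intro a₀ θ₀ u₀ ha hθ hu ha0 hθ0
  obtain ⟨σ₀, hσ₀, H⟩ := hRE a₀ θ₀ u₀ ha hθ hu ha0 hθ0
  refine ⟨σ₀, hσ₀, fun σ hσ hσ' T ρ θ u hE Φ h0 t ht => ?_⟩
  obtain ⟨hprob, hmain⟩ := H σ hσ hσ' T ρ θ u hE Φ
  obtain ⟨a, hψ, hconc, hkl⟩ := hmain h0 t ht
  exact tendstoHydroFieldsAt_of_klDiv (a := a) Φ hconc hkl

/-- **`EntropyToHydro` holds** (shared glue item stmt-AtomisticToContinuum-0769, here route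
TwoClocks' declaration `RelEntropyVanishing → HydrodynamicLimit`): by
`hydrodynamicLimit_of_relEntropyVanishing`, whose hypothesis is `RelEntropyVanishing` verbatim.
[cite: Yau1991, §2] [cite: KipnisLandim1999, Ch. 6 §1] -/
theorem entropyToHydro_proof :
    Summit.AtomisticToContinuum.HydrodynamicLimit.Theses.TwoClocks.EntropyToHydro := by
  unfold Summit.AtomisticToContinuum.HydrodynamicLimit.Theses.TwoClocks.EntropyToHydro
  intro hRE
  exact hydrodynamicLimit_of_relEntropyVanishing hRE

end Summit.AtomisticToContinuum.HydrodynamicLimit.Theorems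

end
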